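import Summits.QuantumFields.BalabanUV.Beta.WilsonBiStencilWardSocket
import Summits.QuantumFields.BalabanUV.Beta.WardLocusQuartic
import Summits.QuantumFields.BalabanUV.Beta.ColourBasisSU

/-!
# `BalabanUV.Beta.WilsonBiStencilWardSocketPins` — row D1 ∕ (C1), PART 114: THE WILSON LETTER OF THE COARSE WARD CHAIN AT GENERAL PINS — `hWil` ∕ `hWil″` of
# an2 g29's `divW_WrecOf_zero_of_letters` (and PART 112's member-0 cut) for `cE₂ • wilsonW₂ d (t • wsym22 N)` against `c • wilsonA d`, ANY block lattice `L`,
# generator root `ρ`, weights `cH`, `ξ`, under the ONE scalar lock `cH·(cE₂·t)·4N² = c·ξ`, remainder ZERO; colour-free for `SU(N)`, `2 ≤ N`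

HONEST DEPENDENCY (page 1, mandatory): continuum YM on T⁴ ⇐ BetaPertH ∧ nine spine estimates (0/9 proved); BetaPertH ⇐ (D1) ∧ (D4) ∧ CAP+tail;
G-an2-4 gates asym, D1 and NE2/3/4.  HONEST FRAMING (cell contract, verbatim): «discharging `BetaPertH` makes Bałaban's UV stability UNCONDITIONAL —
a real constructive-QFT result; it is NOT the continuum limit and NOT the Clay problem.»  ABSOLUTE RULE (cell charter, verbatim): «No internally-minted
statement may enter as a cited fact. Every hypothesis is either kernel-proved in this package or a verbatim quotation of a PUBLISHED theorem with page
reference. The manuscript(s) under audit are NOT citable for their own disputed steps — they are the thing under adjudication; programme-internal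
(2001/route/tribunal) claims are never citable.»

WHY (an2 gen 87; HWD-SCOPING §1c row `hWil`).  leaf-09's `WilsonBiStencilWardSocket.hS₂_wilson ∕ hS₂''_wilson` give the Wilson rows for `wilsonW₂ d (wsym22 N)` at general
`cH c ξ L ρ` under `cH·4N² = c·ξ`; the tree's instances in the `cE₂ • wilsonW₂ d (t • wsym22 N)` shape of the letter (`WardLocusWilsonZero.hWil_wsym22`,
`WilsonWardSocketFit.hWil_wilson_TW`, `WilsonWardColourFree.…_su`) are pinned at the ONE-STEP member-0 values `cH = (stepScale 0·Lc^{d+1})⁻¹`, `c = Lc^{d+1}`, `ξ = ½`.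
The N-system's composite triple (PART 103 ∕ skeleton Y) reads the same letter at block lattice `Lc^(j+1)`, `cH = ((Lc^(j+1))⁴)⁻¹`, `c = P.cE (j+1)`, `ξ = cH·P.cE (j+1)·½`,
`T = P.T (j+1)` pinned to `(8N²)⁻¹ • wsym22 N`, root `ctr 4 (Lc^(j+1))`.  THIS FILE states the letter ONCE at general pins: §1 **`hWil_wsym22_of_lock`** ∕ **`hWil''_wsym22_of_lock`**
(`wilsonW₂_smul`, `divV_smul`, then `hS₂_wilson`∕`hS₂''_wilson`); §2 **`…_su`** colour-free for `SU(N)`, `2 ≤ N` (an3∕leaf-09 `ColourBasisSU`).  The remainder is `0`, whose class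
and parity the consumer takes from `HessKerRate.biLoc_zero` ∕ `SpineRecursiveParity.parityOdd_zero`.

WHAT: [folklore] finite algebra BY NAME; no `def`, no `def … : Prop`, nothing cited, 0 sorry.  Nothing of Bałaban's asserted, valued or discharged; 0 estimates; 0∕4 row-D1
binders; (W)_j NOT claimed; NOT (C1), NOT D1, NEVER «G-an2-4 closed», NOT BetaPertH, NOT continuum, NOT Clay.  Row D1 ∕ (C1) OWNER «beta-an2», gen 87, 2026-08-30.
No existing file touched.
-/

noncomputable section

namespace Summit.QuantumFields.BalabanUV.Beta.WilsonBiStencilWardSocketPins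

open Finset
open scoped BigOperators
open Literature.MathematicalPhysics.QuantumFieldTheory.Balaban1983to89
open Literature.MathematicalPhysics.QuantumFieldTheory.Balaban1983to89.Beta
open WilsonVertex2Sym (wsym22)
open WilsonBiStencil (wilsonW₂ wilsonW₂_smul)
open StepJetData (wilsonA)
open ExpKernelCalculus (MKer comp)
open OneStepResolventKernel (Fib)
open KernelWard (divV)
open AffineAveraging (box toSite)
open ColourTrace (Complete TrOrthonormal)
open Summit.QuantumFields.BalabanUV.Beta.BorderedHessian (diagK)
open Summit.QuantumFields.BalabanUV.Beta.AveragingWardRootedStencils (legInd)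
open Summit.QuantumFields.BalabanUV.Beta.WardLocusQuartic (divV_smul)
open Summit.QuantumFields.BalabanUV.Beta.ColourBasisSU (suGen suGen_complete suGen_trOrthonormal diagIndex ne_zero_of_two_le)
open Summit.QuantumFields.BalabanUV.Beta.WilsonBiStencilWardSocket (hS₂_wilson hS₂''_wilson)

/-! ## §1 General pins, any colour data -/

section General

variable {d L N : ℕ} {C : Type*} [Fintype C] [DecidableEq C] {τ : C → Matrix (Fin N) (Fin N) ℂ}

/-- [folklore] **`hWil_wsym22_of_lock` — THE WILSON LETTER, FIRST SLOT, GENERAL PINS, REMAINDER ZERO**: for `T := t • wsym22 N`, any block lattice `L`, root `ρ`, weights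
`cH c ξ cE₂ t` under the lock `cH·(cE₂·t)·4N² = c·ξ`:
`cH • Σ_{v ∈ box L} divV (κ u ↦ cE₂ • wilsonW₂ d T κ u κ′ u′) (L•Y + v) = comp (c • wilsonA d κ′ u′) (X Y) − comp (X Y) (c • wilsonA d κ′ u′) + 0`, `X Y = diagK (ξ • Σ_v legInd ρ (L•Y + v))`
— g29's `hWil` with `RW := 0`. -/
theorem hWil_wsym22_of_lock (hτ : Complete τ) (ho : TrOrthonormal τ) (hN : N ≠ 0) (cc : C) (ρ : Fin (d + 1) → ℤ) {cH c ξ cE₂ t : ℝ}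
    (hlock : cH * (cE₂ * t) * (4 * (N : ℝ) ^ 2) = c * ξ) (Y : Fin (d + 1) → ℤ) (κ' : Fin (d + 1)) (u' : Fin (d + 1) → ℤ) :
    cH • ∑ v ∈ box (d + 1) L, divV (fun κ u => cE₂ • wilsonW₂ d (t • wsym22 N) κ u κ' u') ((L : ℤ) • Y + toSite v) =
      comp (c • wilsonA d κ' u') (diagK (ξ • ∑ v ∈ box (d + 1) L, legInd ρ ((L : ℤ) • Y + toSite v)))
        - comp (diagK (ξ • ∑ v ∈ box (d + 1) L, legInd ρ ((L : ℤ) • Y + toSite v))) (c • wilsonA d κ' u')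
        + (fun (_ : Fin (d + 1) → ℤ) (_ : Fin (d + 1)) (_ : Fin (d + 1) → ℤ) => (0 : MKer (d + 1) (Fib d))) Y κ' u' := by
  have h1 : ∀ w : Fin (d + 1) → ℤ, divV (fun κ u => cE₂ • wilsonW₂ d (t • wsym22 N) κ u κ' u') w =
      (cE₂ * t) • divV (fun κ u => wilsonW₂ d (wsym22 N) κ u κ' u') w := by
    intro w
    have : (fun κ u => cE₂ • wilsonW₂ d (t • wsym22 N) κ u κ' u') = fun κ u => (cE₂ * t) • wilsonW₂ d (wsym22 N) κ u κ' u' := by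
      funext κ u; rw [wilsonW₂_smul, smul_smul]
    rw [this]
    exact divV_smul (cE₂ * t) (fun κ u => wilsonW₂ d (wsym22 N) κ u κ' u') w
  simp_rw [h1]
  rw [← Finset.smul_sum, smul_smul]
  exact hS₂_wilson hτ ho hN cc L ρ hlock Y κ' u'

/-- [folklore] **`hWil''_wsym22_of_lock` — THE SAME, SECOND SLOT** (`hS₂''_wilson`) — g29's `hWil''` with `RW″ := 0`. -/
theorem hWil''_wsym22_of_lock (hτ : Complete τ) (ho : TrOrthonormal τ) (hN : N ≠ 0) (cc : C) (ρ : Fin (d + 1) → ℤ) {cH c ξ cE₂ t : ℝ}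
    (hlock : cH * (cE₂ * t) * (4 * (N : ℝ) ^ 2) = c * ξ) (Y : Fin (d + 1) → ℤ) (κ : Fin (d + 1)) (u : Fin (d + 1) → ℤ) :
    cH • ∑ v ∈ box (d + 1) L, divV (fun κ' u' => cE₂ • wilsonW₂ d (t • wsym22 N) κ u κ' u') ((L : ℤ) • Y + toSite v) =
      comp (c • wilsonA d κ u) (diagK (ξ • ∑ v ∈ box (d + 1) L, legInd ρ ((L : ℤ) • Y + toSite v)))
        - comp (diagK (ξ • ∑ v ∈ box (d + 1) L, legInd ρ ((L : ℤ) • Y + toSite v))) (c • wilsonA d κ u)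
        + (fun (_ : Fin (d + 1) → ℤ) (_ : Fin (d + 1)) (_ : Fin (d + 1) → ℤ) => (0 : MKer (d + 1) (Fib d))) Y κ u := by
  have h1 : ∀ w : Fin (d + 1) → ℤ, divV (fun κ' u' => cE₂ • wilsonW₂ d (t • wsym22 N) κ u κ' u') w =
      (cE₂ * t) • divV (wilsonW₂ d (wsym22 N) κ u) w := by
    intro w
    have : (fun κ' u' => cE₂ • wilsonW₂ d (t • wsym22 N) κ u κ' u') = fun κ' u' => (cE₂ * t) • wilsonW₂ d (wsym22 N) κ u κ' u' := by
      funext κ' u'; rw [wilsonW₂_smul, smul_smul]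
    rw [this]
    exact divV_smul (cE₂ * t) (wilsonW₂ d (wsym22 N) κ u) w
  simp_rw [h1]
  rw [← Finset.smul_sum, smul_smul]
  exact hS₂''_wilson hτ ho hN cc L ρ hlock Y κ u

end General

/-! ## §2 Colour-free: `SU(N)`, `2 ≤ N` -/

section SU

variable {d L N : ℕ}

/-- [folklore] **`hWil_wsym22_of_lock_su`** — §1's first-slot letter for every `SU(N)`, `2 ≤ N` (leaf-09∕an3's `ColourBasisSU`: `suGen` complete and trace-orthonormal). -/
theorem hWil_wsym22_of_lock_su (hN : 2 ≤ N) (ρ : Fin (d + 1) → ℤ) {cH c ξ cE₂ t : ℝ} (hlock : cH * (cE₂ * t) * (4 * (N : ℝ) ^ 2) = c * ξ)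
    (Y : Fin (d + 1) → ℤ) (κ' : Fin (d + 1)) (u' : Fin (d + 1) → ℤ) :
    cH • ∑ v ∈ box (d + 1) L, divV (fun κ u => cE₂ • wilsonW₂ d (t • wsym22 N) κ u κ' u') ((L : ℤ) • Y + toSite v) =
      comp (c • wilsonA d κ' u') (diagK (ξ • ∑ v ∈ box (d + 1) L, legInd ρ ((L : ℤ) • Y + toSite v)))
        - comp (diagK (ξ • ∑ v ∈ box (d + 1) L, legInd ρ ((L : ℤ) • Y + toSite v))) (c • wilsonA d κ' u')
        + (fun (_ : Fin (d + 1) → ℤ) (_ : Fin (d + 1)) (_ : Fin (d + 1) → ℤ) => (0 : MKer (d + 1) (Fib d))) Y κ' u' :=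
  hWil_wsym22_of_lock (L := L) (suGen_complete (ne_zero_of_two_le hN)) (suGen_trOrthonormal N) (ne_zero_of_two_le hN) (diagIndex hN) ρ hlock Y κ' u'

/-- [folklore] **`hWil''_wsym22_of_lock_su`** — §1's second-slot letter for every `SU(N)`, `2 ≤ N`. -/
theorem hWil''_wsym22_of_lock_su (hN : 2 ≤ N) (ρ : Fin (d + 1) → ℤ) {cH c ξ cE₂ t : ℝ} (hlock : cH * (cE₂ * t) * (4 * (N : ℝ) ^ 2) = c * ξ)
    (Y : Fin (d + 1) → ℤ) (κ : Fin (d + 1)) (u : Fin (d + 1) → ℤ) :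
    cH • ∑ v ∈ box (d + 1) L, divV (fun κ' u' => cE₂ • wilsonW₂ d (t • wsym22 N) κ u κ' u') ((L : ℤ) • Y + toSite v) =
      comp (c • wilsonA d κ u) (diagK (ξ • ∑ v ∈ box (d + 1) L, legInd ρ ((L : ℤ) • Y + toSite v)))
        - comp (diagK (ξ • ∑ v ∈ box (d + 1) L, legInd ρ ((L : ℤ) • Y + toSite v))) (c • wilsonA d κ u)
        + (fun (_ : Fin (d + 1) → ℤ) (_ : Fin (d + 1)) (_ : Fin (d + 1) → ℤ) => (0 : MKer (d + 1) (Fib d))) Y κ u :=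
  hWil''_wsym22_of_lock (L := L) (suGen_complete (ne_zero_of_two_le hN)) (suGen_trOrthonormal N) (ne_zero_of_two_le hN) (diagIndex hN) ρ hlock Y κ u

/-- [folklore] **AT THE COARSE WARD CHAIN's PINS** `ξ := cH·c·½`, `t := (8N²)⁻¹` (skeleton Y's `hTW`; `cH ≠ 0` free): the lock reads `cE₂ = c²` — the first slot. -/
theorem hWil_wsym22_TW_su (hN : 2 ≤ N) (ρ : Fin (d + 1) → ℤ) {cH c cE₂ : ℝ} (hcE₂ : cE₂ = c ^ 2)
    (Y : Fin (d + 1) → ℤ) (κ' : Fin (d + 1)) (u' : Fin (d + 1) → ℤ) :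
    cH • ∑ v ∈ box (d + 1) L, divV (fun κ u => cE₂ • wilsonW₂ d ((8 * (N : ℝ) ^ 2)⁻¹ • wsym22 N) κ u κ' u') ((L : ℤ) • Y + toSite v) =
      comp (c • wilsonA d κ' u') (diagK ((cH * c * (1 / 2 : ℝ)) • ∑ v ∈ box (d + 1) L, legInd ρ ((L : ℤ) • Y + toSite v)))
        - comp (diagK ((cH * c * (1 / 2 : ℝ)) • ∑ v ∈ box (d + 1) L, legInd ρ ((L : ℤ) • Y + toSite v))) (c • wilsonA d κ' u')
        + (fun (_ : Fin (d + 1) → ℤ) (_ : Fin (d + 1)) (_ : Fin (d + 1) → ℤ) => (0 : MKer (d + 1) (Fib d))) Y κ' u' := by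
  have hN0 : (N : ℝ) ≠ 0 := by exact_mod_cast ne_zero_of_two_le hN
  refine hWil_wsym22_of_lock_su (L := L) hN ρ ?_ Y κ' u'
  rw [hcE₂]
  field_simp
  ring

/-- [folklore] the same, second slot. -/
theorem hWil''_wsym22_TW_su (hN : 2 ≤ N) (ρ : Fin (d + 1) → ℤ) {cH c cE₂ : ℝ} (hcE₂ : cE₂ = c ^ 2)
    (Y : Fin (d + 1) → ℤ) (κ : Fin (d + 1)) (u : Fin (d + 1) → ℤ) :
    cH • ∑ v ∈ box (d + 1) L, divV (fun κ' u' => cE₂ • wilsonW₂ d ((8 * (N : ℝ) ^ 2)⁻¹ • wsym22 N) κ u κ' u') ((L : ℤ) • Y + toSite v) =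
      comp (c • wilsonA d κ u) (diagK ((cH * c * (1 / 2 : ℝ)) • ∑ v ∈ box (d + 1) L, legInd ρ ((L : ℤ) • Y + toSite v)))
        - comp (diagK ((cH * c * (1 / 2 : ℝ)) • ∑ v ∈ box (d + 1) L, legInd ρ ((L : ℤ) • Y + toSite v))) (c • wilsonA d κ u)
        + (fun (_ : Fin (d + 1) → ℤ) (_ : Fin (d + 1)) (_ : Fin (d + 1) → ℤ) => (0 : MKer (d + 1) (Fib d))) Y κ u := by
  have hN0 : (N : ℝ) ≠ 0 := by exact_mod_cast ne_zero_of_two_le hN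
  refine hWil''_wsym22_of_lock_su (L := L) hN ρ ?_ Y κ u
  rw [hcE₂]
  field_simp
  ring

end SU

end Summit.QuantumFields.BalabanUV.Beta.WilsonBiStencilWardSocketPins

end
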